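-- STATUS (stub_arp worker, seat c2, 2026-08-16T16:20Z): target Summits/.../Theorems/ParabolicTrajectoryContinuumLimitOnTrajectoryStubArpT.lean.
-- Expects tree imports: …StubArpA (built), Literature…SchwartzTranslationCutoff, Literature…SchwingerOSCluster (built).
-- Compiled standalone against the tree (lean check rc 0, 0 warnings) and in the concatenated scratch. Anchor arpT_isOffDiagonal_sub registered.
import Summits.QuantumFields.YangMills.Theorems.ParabolicTrajectoryContinuumLimitOnTrajectoryStubArpA
import Literature.MathematicalPhysics.QuantumLattice.SchwartzTranslationCutoff
import Literature.MathematicalPhysics.QuantumLattice.SchwingerOSCluster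

/-!
# Stub `stub_arp : ARPOfRP` (line `two-orbit-synchronisation`, crux stmt-QuantumFields-10522), part T:
# the `k`-independent truncation of a Gram sum

Helper file of the stub worker for `stub_arp` (seat c2), independent of parts B/C (needs only `UVB` and the linearity of
`curvDistribution`). Under `UVB`, the time-ordered test functions `Fⱼ` of a Gram sum `∑ᵢⱼ curvDistribution k (ΘFᵢ* ⊗ Fⱼ)` can be
replaced by COMPACT CUTOFFS `F'ⱼ` (the bump cutoffs of `SchwartzTranslationCutoff`, supported inside `tsupport Fⱼ ∩ B̄(0, R)`) at a
cost `≤ ε` on the Gram sum, eventually in `k` (`Arp.exists_truncation`): the differences `ΘFᵢ* ⊗ Fⱼ − ΘF'ᵢ* ⊗ F'ⱼ` are finitely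
many FIXED off-diagonal test functions (`⁰𝒮` is stable under differences, `isOffDiagonal_sub`) that are small in `𝒮` by the
joint continuity of `⊗` and the continuity of `Θ·*`.
-/

set_option autoImplicit false

open scoped SchwartzMap ComplexConjugate
open MeasureTheory Filter Topology
open Literature.MathematicalPhysics.QuantumFieldTheory Literature.MathematicalPhysics.QuantumLattice
open Literature.MathematicalPhysics.AQFT Literature.Probability.LatticeModels
open Summit.QuantumFields.YangMills.Theses.ParabolicTrajectory

noncomputable section

namespace Summit.QuantumFields.YangMills.Cruxes.ContinuumLimitOnTrajectory.TwoOrbitSynchronisation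

local notation "𝔼" => EuclideanSpace ℝ (Fin 4)

namespace Arp

section Truncation

variable {G : Type} [Group G] [TopologicalSpace G] [IsTopologicalGroup G] [CompactSpace G]
  [MeasurableSpace G] [BorelSpace G]

omit [TopologicalSpace G] [IsTopologicalGroup G] [CompactSpace G] [MeasurableSpace G] [BorelSpace G] [Group G] in
/-- `⁰𝒮` is stable under differences. -/
theorem isOffDiagonal_sub {n : ℕ} {F F' : 𝓢((Fin n → 𝔼), ℂ)} (hF : IsOffDiagonal F) (hF' : IsOffDiagonal F') :
    IsOffDiagonal (F - F') := by
  rw [sub_eq_add_neg, ← neg_one_smul ℂ F']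
  exact hF.add (hF'.smul (-1))

/-- **`k`-independent truncation.** Under `UVB`, the time-ordered test functions of a Gram sum can be replaced by
compact cutoffs supported inside `tsupport Fⱼ ∩ B̄(0, R)` at a cost `≤ ε` on the Gram sum, eventually in `k`. -/
theorem exists_truncation (r : LatticeRep G) (sch : SpeciesScheme (YMSpecies G)) (hV : UVB r sch) {N : ℕ}
    (deg : Fin N → ℕ) (F : (j : Fin N) → 𝓢((Fin (deg j) → 𝔼), ℂ)) (hF : ∀ j, IsTimeOrdered (F j))
    (H : (i j : Fin N) → 𝓢((Fin (deg i + deg j) → 𝔼), ℂ))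
    (hH : ∀ i j, IsAppendTensorOf (H i j) (osAdjoint (F i)) (F j)) {ε : ℝ} (hε : 0 < ε) :
    ∃ (R : ℝ) (F' : (j : Fin N) → 𝓢((Fin (deg j) → 𝔼), ℂ)), 0 ≤ R ∧
      (∀ j, tsupport (F' j : (Fin (deg j) → 𝔼) → ℂ) ⊆
        tsupport (F j : (Fin (deg j) → 𝔼) → ℂ) ∩ Metric.closedBall 0 R) ∧
      ∀ᶠ k in atTop, ‖(∑ i, ∑ j, curvDistribution r sch k (deg i + deg j) (H i j)) -
        ∑ i, ∑ j, curvDistribution r sch k (deg i + deg j) ((osAdjoint (F' i)).appendTensor (F' j))‖ ≤ ε := by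
  obtain ⟨s, α, β, hUVB⟩ := hV
  choose u hu hlim using fun j => exists_tsupport_subset_inter_closedBall_tendsto (F j)
  have hHeq : ∀ i j, H i j = (osAdjoint (F i)).appendTensor (F j) := fun i j => by
    ext x; rw [hH i j x, SchwartzMap.appendTensor_apply]
  -- the cutoff Gram tensors converge in `𝒮`
  set Hm : (i j : Fin N) → ℕ → 𝓢((Fin (deg i + deg j) → 𝔼), ℂ) := fun i j m => (osAdjoint (u i m)).appendTensor (u j m)
    with hHm
  have hHlim : ∀ i j, Tendsto (fun m => Hm i j m) atTop (𝓝 (H i j)) := fun i j => by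
    rw [hHeq i j]
    exact SchwartzMap.tendsto_appendTensor ((continuous_osAdjoint.tendsto _).comp (hlim i)) (hlim j)
  set C : Fin N → Fin N → ℝ := fun i j => max α 0 * ((deg i + deg j).factorial : ℝ) ^ β with hC
  have hC0 : ∀ i j, 0 ≤ C i j := fun i j => by positivity
  have hsn : ∀ i j, Tendsto (fun m => C i j * schwartzNorm ((deg i + deg j) * s) (H i j - Hm i j m)) atTop (𝓝 0) := by
    intro i j
    have h1 : Tendsto (fun m => H i j - Hm i j m) atTop (𝓝 (H i j - H i j)) := tendsto_const_nhds.sub (hHlim i j)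
    rw [sub_self] at h1
    have h2 := ((continuous_schwartzSeminorm (deg i + deg j) ((deg i + deg j) * s)).tendsto 0).comp h1
    rw [map_zero] at h2
    have h3 : Tendsto (fun m => C i j * schwartzNorm ((deg i + deg j) * s) (H i j - Hm i j m)) atTop (𝓝 (C i j * 0)) :=
      h2.const_mul (C i j)
    rwa [mul_zero] at h3
  set ε' : ℝ := ε / ((N : ℝ) + 1) ^ 2 with hε'
  have hε'0 : 0 < ε' := by positivity
  have hev : ∀ᶠ m in atTop, ∀ ij : Fin N × Fin N,
      C ij.1 ij.2 * schwartzNorm ((deg ij.1 + deg ij.2) * s) (H ij.1 ij.2 - Hm ij.1 ij.2 m) ≤ ε' :=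
    eventually_all.2 fun ij => ((hsn ij.1 ij.2).eventually_lt_const hε'0).mono fun m hm => hm.le
  obtain ⟨m₀, hm₀⟩ := hev.exists
  refine ⟨2 * ((m₀ : ℝ) + 1), fun j => u j m₀, by positivity, fun j => hu j m₀, ?_⟩
  -- `UVB` on the finitely many off-diagonal differences
  have hF'ord : ∀ j, IsTimeOrdered (u j m₀) := fun j x hx => hF j ((hu j m₀ hx).1)
  have hoff : ∀ i j, IsOffDiagonal (H i j - Hm i j m₀) := fun i j =>
    isOffDiagonal_sub (isOffDiagonal_of_isAppendTensorOf_zero (hF i) (hF j) (hH i j))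
      (isOffDiagonal_of_isAppendTensorOf_zero (hF'ord i) (hF'ord j) (isAppendTensorOf_appendTensor _ _))
  have hevk : ∀ᶠ k in atTop, ∀ ij : Fin N × Fin N,
      ‖curvDistribution r sch k (deg ij.1 + deg ij.2) (H ij.1 ij.2 - Hm ij.1 ij.2 m₀)‖ ≤
        α * ((deg ij.1 + deg ij.2).factorial : ℝ) ^ β *
          schwartzNorm ((deg ij.1 + deg ij.2) * s) (H ij.1 ij.2 - Hm ij.1 ij.2 m₀) :=
    eventually_all.2 fun ij => hUVB _ _ (hoff ij.1 ij.2)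
  filter_upwards [hevk] with k hk
  have hdiff : (∑ i, ∑ j, curvDistribution r sch k (deg i + deg j) (H i j)) -
      ∑ i, ∑ j, curvDistribution r sch k (deg i + deg j) ((osAdjoint (u i m₀)).appendTensor (u j m₀)) =
      ∑ i, ∑ j, curvDistribution r sch k (deg i + deg j) (H i j - Hm i j m₀) := by
    rw [← Finset.sum_sub_distrib]
    refine Finset.sum_congr rfl fun i _ => ?_
    rw [← Finset.sum_sub_distrib]
    refine Finset.sum_congr rfl fun j _ => ?_
    rw [curvDistribution_sub]
  rw [hdiff]
  have hterm : ∀ i j, ‖curvDistribution r sch k (deg i + deg j) (H i j - Hm i j m₀)‖ ≤ ε' := by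
    intro i j
    refine ((hk (i, j)).trans ?_).trans (hm₀ (i, j))
    exact mul_le_mul_of_nonneg_right (mul_le_mul_of_nonneg_right (le_max_left _ _) (by positivity))
      (schwartzNorm_nonneg _ _)
  calc ‖∑ i, ∑ j, curvDistribution r sch k (deg i + deg j) (H i j - Hm i j m₀)‖
      ≤ ∑ i, ∑ j, ‖curvDistribution r sch k (deg i + deg j) (H i j - Hm i j m₀)‖ :=
        (norm_sum_le _ _).trans (Finset.sum_le_sum fun i _ => norm_sum_le _ _)
    _ ≤ ∑ _i : Fin N, ∑ _j : Fin N, ε' := Finset.sum_le_sum fun i _ => Finset.sum_le_sum fun j _ => hterm i j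
    _ = (N : ℝ) * ((N : ℝ) * ε') := by simp
    _ ≤ ε := by
        rw [hε', ← mul_assoc, mul_div_assoc']
        rw [div_le_iff₀ (by positivity)]
        nlinarith [hε.le, (Nat.cast_nonneg N : (0 : ℝ) ≤ N)]

end Truncation

end Arp

/-- **Registered anchor of this file** (closed form of `Arp.isOffDiagonal_sub`, for the gate's `--supports` stub check):
`⁰𝒮` is stable under differences. -/
theorem arpT_isOffDiagonal_sub :
    ∀ {n : ℕ} {F F' : 𝓢((Fin n → EuclideanSpace ℝ (Fin 4)), ℂ)}, IsOffDiagonal F → IsOffDiagonal F' →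
      IsOffDiagonal (F - F') := by
  intro n F F' hF hF'
  exact Arp.isOffDiagonal_sub hF hF'

end Summit.QuantumFields.YangMills.Cruxes.ContinuumLimitOnTrajectory.TwoOrbitSynchronisation

end
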